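import Summits.HodgeConjecture.HodgeConjecture.Theorems.Ring2ClassTargetsWeilPullbackGenerated
import HarnessLib

/-!
# Ring 2 — class targets: the FULL Weil-pull-back member shape (two seed sets) for rows `6, 7` (typer 1)

research route conditional on HC_CM; not a corollary; Q11.4-sentence-2 already refuted in dim ≥ 3.

Cell `pub-hodge-ring2`, seat typer1 = cell LEAD (gen 9, ruling L9.3 (i) / LEAD ACTION (K)). `HC_CM` := the binder
`Theses.RankFourFaces.CMAbelianHodge` (stmt-HodgeConjecture-3052) BY NAME; nothing here proves it, `HC_AV`
(stmt-1333) or `CMToAbelian` (stmt-16267); nothing here is a new case of the Hodge conjecture. No `sorry`, no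
named fact. New DEFINITIONS (typed HYPOTHESIS SHAPES / seed sets on a member, nothing asserted):
`IsCodimThreeGeneratedBy`, `codimThreeWeilSixfoldPullbacks`, `IsFullWeilPullbackGenerated` (§K0).

PURPOSE. `Ring2ClassTargetsWeilPullbackGenerated` (p194357) types the K3-PARTNER SHAPE (P) =
`IsWeilPullbackGenerated A`: codimension `2` generated by `D²` and the codimension-2 Weil pull-backs
`codimTwoWeilPullbacks A` (X2′'s third summand), codimension `3` by `D³` and `B²·B¹` ONLY. Typer 2's answer to
(b′) (RING2-MAP §hypotheses gen 11, table XIX.2, `Ring2HypothesesMultiWeilVsPullbacks`, p194823) reads the 44 atlas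
rows of dimensions `6, 7`: (P) serves exactly the three K3 partners, typer 2's multi-Weil shape (G) exactly the
nine Weil-type SIXFOLD rows, the 25 rows with `B = D` need neither — and the FIVE SEVENFOLD ROWS WITH `B ≠ D`
(`E × Y₆`, `E² × Y₅`, `E³ × Y₄` with their `(3, ·)` Weil sixfold inside; `Y₃ × Y₃′ × E`; the "dim-7 twin"
`E_{k₂} × Y₆` of the K3 partners) are served by NEITHER member shape: their excess `(3,3)` classes are pull-backs
`g^* w` of Weil classes of a Weil-type SIXFOLD (`pr^* W_k(Y₆)`, …), which is X1's FOURTH summand — absent from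
(P)'s product clause (typer 2, reading rule r5) and, in odd dimension, from (G). This file types the missing member
shape (P⁺) = `IsFullWeilPullbackGenerated A`: codimension `2` as in (P); codimension `3` generated by `D³`, `B²·B¹`
AND a second seed set `codimThreeWeilSixfoldPullbacks A` = X1's fourth summand on the member, verbatim. §K1: the
ENGINE with two algebraic seed sets (`dim A ≤ 7`; Lefschetz `(1,1)`, divisor monomials, `N²·N¹ ⊆ N³`, hard
Lefschetz — as §G1 of p194357); §K2: the PRICE of the new seeds is `W₆` (`Theses.SevenfoldWeilCensus.WeilSixfolds`,
stmt-2524, by name) or HC on a class `𝒞` + `WeilSixfoldsOff 𝒞`, or R∞ (`WeilClassesImaginaryQuadratic`), or `HC_CM`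
+ the two QUADRATIC transport leaves; §K3: (P) ⟹ (P⁺), (P⁺) ⟹ the census clauses X2′ / X1 at the member, and the
per-member theorems in four readings — (R⁺) floor fact ∧ R3 (codimension-2 slice) ∧ `W₆`: `HC_CM` ABSENT; (L⁺) the
two ladder rungs R∞ ∧ R3: `HC_CM` ABSENT; (C⁺) HC on `𝒞` ∧ floor ∧ the two prices off `𝒞` (with `𝒞 = CM`: `HC_CM`
INSTANCE + prices off the CM locus); (T⁺) `HC_CM` + the four transport leaves (`HC_CM` = the CM anchor of both
transports); §K4: rows `6, 7` from the member shape OFF a class (no induction on dimension: the shape has no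
lower-dimensional summand), and the census rows X2′ ∧ X1 off `𝒞` as a COROLLARY of the shape off `𝒞`; §K5 audit.
After this file every one of the 44 atlas rows of dimensions `6, 7` read off by typer 2 carries a typed member
shape with a named price: `B = D` (free) | (G) or (P⁺) with `W₆` | (P) with floor + R3-slice | (P⁺) with floor +
R3-slice + `W₆` (the twin). Which rows HAVE which shape is atlas numbers + inference / cell computation (typer 2
XIX.2 honest column (h1)), entered below only as HYPOTHESES on members.

Honest column: the shapes are Hodge-theoretic census statements about a member (NOT consequences of HC, except the
trivial codimension-`2`/`3` shapes with all algebraic classes as seeds, §K5); the floor fact is Markman's fourfold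
theorem (arXiv:2502.03415 Thm. 1.5.1 / Cor. 1.6.1, UNREFEREED); `W₆`, R3, R∞ and the transport leaves are OPEN typed
statements; every PRICE is a consequence of `HodgeConjecture` (§K5).
References: [cite: MoonenZarhin1999LowDim, Thm. 0.2 (e),(f), §2 and §5; arXiv:math/9901113]
[cite: vanGeemen1994HodgeAV, §2.4–2.5, Thm. 4.11, Thm. 6.12] [cite: Andre1992HodgeCM, Théorème]
[cite: Markman2025SecantWeil, Thm. 1.5.1, Cor. 1.6.1 (preprint, unrefereed)] [cite: MoonenZarhin1998WeilClasses, §1]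
[cite: VoisinHodgeI2002, Thms. 6.25, 11.30] [cite: VoisinHodgeII2003, Prop. 9.20] [cite: Deligne1982HodgeCycles, §4–5]
[cite: Milne1999, §7 (H)] [cite: Deligne2000, §1]
-/

set_option linter.dupNamespace false

noncomputable section

open CategoryTheory Literature.AlgebraicGeometry Literature.AlgebraicGeometry.Motives
open Literature.AlgebraicGeometry.HodgeTheory Literature.AlgebraicGeometry.Milne1999
open Literature.AlgebraicTopology.SingularHomology Literature.Barriers.HodgeConjecture

namespace Summit.HodgeConjecture.HodgeConjecture.Ring2.ClassTargets

open WeilTypeLadder Ring2Transport Ring2.Atlas Ring2.Motiv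

/-! ## §K0 The second seed set and the full shape (definitions; hypotheses, never asserted) -/

/-- **Codimension-`3` generation by divisors, `B²·B¹` and a SEED SET `T`**: every rational `(3,3)` class of `A`
lies in `D³(A) ⊔ span (B² ⌣ B¹) ⊔ span T` — X1's first two summands (verbatim) plus `T`, on the member. With
`T = ∅` this is p194357's `IsCodimThreeProductGenerated A` (§K3). [cite: MoonenZarhin1999LowDim, §2 and §5] -/
def IsCodimThreeGeneratedBy (A : AbelianVariety ℂ) (T : Set (complexBetti A.X (2 * 3))) : Prop :=
  ∀ c : complexBetti A.X (2 * 3), IsRationalClass c → IsOfHodgeType A.dim A.X (2 * 3) 3 3 c →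
    c ∈ divisorClassesSpan A.X A.dim 3 ⊔ Submodule.span ℂ {w' : complexBetti A.X (2 * 3) |
      ∃ (a : complexBetti A.X (2 * 2)) (b : complexBetti A.X (2 * 1)),
        IsRationalClass a ∧ IsOfHodgeType A.dim A.X (2 * 2) 2 2 a ∧ IsRationalClass b ∧
        IsOfHodgeType A.dim A.X (2 * 1) 1 1 b ∧ w' = cupProduct (two_mul_add_two_mul 2 1) a b} ⊔
      Submodule.span ℂ T

/-- **Codimension-`3` Weil-SIXFOLD pull-backs**: pull-backs `g^* w` to `A`, along ANY morphism `g : A.X ⟶ B.X`, of a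
rational `(3,3)` Weil class `w ∈ weilClassesOf B ψ 3 d` of an abelian SIXFOLD `B` with `ψ ≫ ψ = -d` (`K = ℚ(√-d)`)
— VERBATIM the fourth summand of X1 = `Theses.SevenfoldWeilCensus.CodimThreeWeilGeneration` /
`CodimThreeWeilGenerationOff` at the member (e.g. `pr^* W_k(Y₆)` on `E × Y₆`; `B = A`, `g = 𝟙` for a Weil sixfold
itself). [cite: vanGeemen1994HodgeAV, Thm. 4.11 and Thm. 6.12] [cite: MoonenZarhin1999LowDim, §5] -/
def codimThreeWeilSixfoldPullbacks (A : AbelianVariety ℂ) : Set (complexBetti A.X (2 * 3)) :=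
  {w' : complexBetti A.X (2 * 3) |
    ∃ (B : AbelianVariety ℂ) (g : A.X ⟶ B.X) (d : ℕ) (ψ : B ⟶ B) (w : complexBetti B.X (2 * 3)),
      B.dim = 6 ∧ 0 < d ∧ ψ ≫ ψ = -(d • 𝟙 B) ∧ IsRationalClass w ∧
      IsOfHodgeType B.dim B.X (2 * 3) 3 3 w ∧ w ∈ weilClassesOf B ψ 3 d ∧
      w' = complexBetti.map g (2 * 3) w}

/-- **`IsFullWeilPullbackGenerated A` — the shape (P⁺)**: codimension `2` generated by `D²` and the codimension-2
Weil pull-backs `codimTwoWeilPullbacks A` (as in (P)), codimension `3` by `D³`, `B²·B¹` AND the Weil-sixfold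
pull-backs `codimThreeWeilSixfoldPullbacks A`. Both Weil summands of the census rows X2′ / X1, none of their
lower-dimensional summands. A HYPOTHESIS on the member (typer 2's table XIX.2 reads it on the five `B ≠ D`
sevenfold rows; inference r5 + certified numbers, not kernel). [cite: MoonenZarhin1999LowDim, §5]
[cite: vanGeemen1994HodgeAV, Thm. 6.12] -/
def IsFullWeilPullbackGenerated (A : AbelianVariety ℂ) : Prop :=
  IsCodimTwoGeneratedBy A (codimTwoWeilPullbacks A) ∧ IsCodimThreeGeneratedBy A (codimThreeWeilSixfoldPullbacks A)

/-- Monotonicity in the codimension-`3` seed set. [folklore] -/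
theorem IsCodimThreeGeneratedBy.mono {A : AbelianVariety ℂ} {T T' : Set (complexBetti A.X (2 * 3))}
    (h : IsCodimThreeGeneratedBy A T) (hTT' : T ⊆ T') : IsCodimThreeGeneratedBy A T' := by
  intro c hc hct
  obtain ⟨y, hy, z, hz, rfl⟩ := Submodule.mem_sup.1 (h c hc hct)
  exact Submodule.mem_sup.2 ⟨y, hy, z, Submodule.span_mono hTT' hz, rfl⟩

/-- p194357's product shape is generation by the EMPTY second seed set, and conversely. [folklore] -/
theorem isCodimThreeGeneratedBy_empty_iff (A : AbelianVariety ℂ) :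
    IsCodimThreeGeneratedBy A ∅ ↔ IsCodimThreeProductGenerated A := by
  simp only [IsCodimThreeGeneratedBy, IsCodimThreeProductGenerated, Submodule.span_empty, sup_bot_eq]

/-- The product shape gives generation by ANY second seed set: (P₃) ⟹ (P⁺₃). [folklore] -/
theorem isCodimThreeGeneratedBy_of_isCodimThreeProductGenerated {A : AbelianVariety ℂ}
    (h : IsCodimThreeProductGenerated A) (T : Set (complexBetti A.X (2 * 3))) : IsCodimThreeGeneratedBy A T :=
  fun c hc hct ↦ Submodule.mem_sup_left (h c hc hct)

/-- **(P) ⟹ (P⁺)**: a Weil-pull-back-generated member (K3-partner shape) is fully Weil-pull-back generated.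
[cite: MoonenZarhin1999LowDim, §5] -/
theorem isFullWeilPullbackGenerated_of_isWeilPullbackGenerated {A : AbelianVariety ℂ}
    (h : IsWeilPullbackGenerated A) : IsFullWeilPullbackGenerated A :=
  ⟨h.1, isCodimThreeGeneratedBy_of_isCodimThreeProductGenerated h.2 _⟩

/-! ## §K1 The engine with two seed sets -/

/-- **ENGINE (two seed sets).** For a complex abelian variety `A` of dimension `≤ 7`: if its codimension-`2` classes
are generated by `D²` and an ALGEBRAIC seed set `S`, and its codimension-`3` classes by `D³`, `B²·B¹` and an
ALGEBRAIC seed set `T`, then `HC(A)`. Proof as p194357 §G1: `p = 1` Lefschetz `(1,1)`; `p = 2` divisor monomials +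
`span S ≤ N²`; `p = 3` divisor monomials + `N² ⌣ N¹ ⊆ N³` (Kleiman moving on an abelian variety) + `span T ≤ N³`;
`2p > dim A` hard Lefschetz from codimension `dim A − p ≤ 3`. No floor, no `W₆`, no `HC_CM`.
[cite: VoisinHodgeI2002, Thms. 6.25, 11.30] [cite: VoisinHodgeII2003, Prop. 9.20] -/
theorem hodgeConjectureFor_of_generated_of_two_seed_sets {A : AbelianVariety ℂ} (hA : A.dim ≤ 7)
    {S : Set (complexBetti A.X (2 * 2))} {T : Set (complexBetti A.X (2 * 3))}
    (hS : S ⊆ ↑(algebraicClasses A.X 2)) (hT : T ⊆ ↑(algebraicClasses A.X 3))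
    (h₂ : IsCodimTwoGeneratedBy A S) (h₃ : IsCodimThreeGeneratedBy A T) : HodgeConjectureFor A.dim A.X := by
  have hX : IsSmoothProjective A.dim A.X := AbelianVariety.isSmoothProjective_holds
  have h11 : ∀ b : complexBetti A.X (2 * 1), IsRationalClass b →
      IsOfHodgeType A.dim A.X (2 * 1) 1 1 b → b ∈ algebraicClasses A.X 1 :=
    fun b hb hbt ↦ lefschetzOneOne_rational_holds hX b hb hbt
  have hp2 : ∀ c : complexBetti A.X (2 * 2), IsRationalClass c →
      IsOfHodgeType A.dim A.X (2 * 2) 2 2 c → c ∈ algebraicClasses A.X 2 := fun c hc hct ↦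
    (sup_le (AbelianVariety.divisorClassesSpan_le_algebraicClasses A h11 2) (Submodule.span_le.mpr hS))
      (h₂ c hc hct)
  have hp3 : ∀ c : complexBetti A.X (2 * 3), IsRationalClass c →
      IsOfHodgeType A.dim A.X (2 * 3) 3 3 c → c ∈ algebraicClasses A.X 3 := by
    intro c hc hct
    refine (sup_le (sup_le (AbelianVariety.divisorClassesSpan_le_algebraicClasses A h11 3)
      (Submodule.span_le.mpr ?_)) (Submodule.span_le.mpr hT)) (h₃ c hc hct)
    rintro _ ⟨a, b, ha, hat, hb, hbt, rfl⟩
    exact AbelianVariety.cupProduct_mem_algebraicClasses_one A (hp2 a ha hat) (h11 b hb hbt)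
  have hlow : ∀ p : ℕ, 2 * p ≤ A.dim → ∀ c : complexBetti A.X (2 * p), IsRationalClass c →
      IsOfHodgeType A.dim A.X (2 * p) p p c → c ∈ algebraicClasses A.X p := by
    intro p hp c hc hct
    have hp3' : p ≤ 3 := by omega
    interval_cases p
    · exact hodgeConjectureFor_codim_zero c
    · exact h11 c hc hct
    · exact hp2 c hc hct
    · exact hp3 c hc hct
  refine ⟨nonempty_hodgeModel_holds hX, fun p c hc hct ↦ ?_⟩
  by_cases hp : 2 * p ≤ A.dim
  · exact hlow p hp c hc hct
  · exact mem_algebraicClasses_of_lt_of_nonempty (nonempty_hardLefschetzNFold_holds A.dim A.X) hX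
      (by omega) (hlow (A.dim - p) (by omega)) c hc hct

/-! ## §K2 The codimension-`3` seeds are algebraic — four prices -/

/-- **(C) From HC on a class `𝒞` and `W₆` off `𝒞`**: a sixfold source `B ∈ 𝒞` is paid by `h𝒞`, `B ∉ 𝒞` by
`WeilSixfoldsOff 𝒞`; pull-backs of algebraic classes along morphisms of abelian varieties are algebraic.
[cite: Markman2025SecantWeil, Thm. 1.5.1 (preprint, unrefereed)] [cite: vanGeemen1994HodgeAV, §7.4] -/
theorem codimThreeWeilSixfoldPullbacks_subset_algebraicClasses_of_hcOnClass_of_weilSixfoldsOff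
    {𝒞 : AbelianVariety ℂ → Prop} (h𝒞 : HCOnClass 𝒞) (h₄ : WeilSixfoldsOff 𝒞) (A : AbelianVariety ℂ) :
    codimThreeWeilSixfoldPullbacks A ⊆ ↑(algebraicClasses A.X 3) := by
  have hX : IsSmoothProjective A.dim A.X := AbelianVariety.isSmoothProjective_holds
  rintro _ ⟨B, g, d, ψ, w, hB, hd, hψ, hw, hwt, hweil, rfl⟩
  refine map_mem_algebraicClasses_of_abelianVariety hX B g ?_
  by_cases hB𝒞 : 𝒞 B
  · exact (h𝒞 B hB𝒞).2 3 w hw hwt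
  · exact h₄ d hd B ψ hB hψ hB𝒞 w hw hwt hweil

/-- **(R) From `W₆`** (stmt-2524, by name; `𝒞 = ∅`). `HC_CM` ABSENT. [cite: Markman2025SecantWeil, Thm. 1.5.1 (preprint, unrefereed)] -/
theorem codimThreeWeilSixfoldPullbacks_subset_algebraicClasses_of_weilSixfolds
    (h₄ : Theses.SevenfoldWeilCensus.WeilSixfolds) (A : AbelianVariety ℂ) :
    codimThreeWeilSixfoldPullbacks A ⊆ ↑(algebraicClasses A.X 3) :=
  codimThreeWeilSixfoldPullbacks_subset_algebraicClasses_of_hcOnClass_of_weilSixfoldsOff (𝒞 := fun _ ↦ False)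
    (fun _ h ↦ h.elim) (weilSixfoldsOff_of h₄ _) A

/-- **(L) From the ladder rung R∞** (`WeilClassesImaginaryQuadratic`; `W₆` = R∞[n = 3],
`weilSixfolds_of_weilClassesImaginaryQuadratic`). `HC_CM` ABSENT. [cite: MoonenZarhin1998WeilClasses, §1] -/
theorem codimThreeWeilSixfoldPullbacks_subset_algebraicClasses_of_weilClassesImaginaryQuadratic
    (hR : WeilClassesImaginaryQuadratic) (A : AbelianVariety ℂ) :
    codimThreeWeilSixfoldPullbacks A ⊆ ↑(algebraicClasses A.X 3) :=
  codimThreeWeilSixfoldPullbacks_subset_algebraicClasses_of_weilSixfolds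
    (weilSixfolds_of_weilClassesImaginaryQuadratic hR) A

/-- **(T) From `HC_CM` and the two QUADRATIC transport leaves** (CM-pointed Weil families + Weil-confined variational
Hodge, `K` imaginary quadratic ⇒ R∞ ⇒ `W₆`); `HC_CM` is the CM ANCHOR of the transport.
[cite: Deligne1982HodgeCycles, §4–5] [cite: Milne1999, §7 (H)] -/
theorem codimThreeWeilSixfoldPullbacks_subset_algebraicClasses_of_hcCM_of_transportQuadratic
    (hCM : Theses.RankFourFaces.CMAbelianHodge) (hPq : CMPointedWeilFamiliesQuadratic)
    (hVq : WeilVariationalHodgeQuadratic) (A : AbelianVariety ℂ) :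
    codimThreeWeilSixfoldPullbacks A ⊆ ↑(algebraicClasses A.X 3) :=
  codimThreeWeilSixfoldPullbacks_subset_algebraicClasses_of_weilClassesImaginaryQuadratic
    (HC_WeilClassesQuadratic_of_HC_CM hCM hPq hVq) A

/-! ## §K3 Per-member theorems in four readings; the shape against the census clauses -/

/-- **(R⁺) `HC(A)` for a fully Weil-pull-back-generated `A` of dimension `≤ 7` from the floor fact ∧ R3
(codimension-2 slice at the CM-field sources) ∧ `W₆` — `HC_CM` ABSENT.** The kernel statement for the five `B ≠ D`
sevenfold rows (given their shape). [cite: MoonenZarhin1998WeilClasses, §1]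
[cite: Markman2025SecantWeil, Thm. 1.5.1, Cor. 1.6.1 (preprint, unrefereed)] [cite: VoisinHodgeI2002, Thms. 6.25, 11.30] -/
theorem hodgeConjectureFor_of_isFullWeilPullbackGenerated_of_floor_of_weilClassesCMField_of_weilSixfolds
    {A : AbelianVariety ℂ} (hA : A.dim ≤ 7) (hgen : IsFullWeilPullbackGenerated A)
    (hW : Markman2025_weilClasses_algebraic_abelianFourfold) (hR3 : WeilClassesCMField)
    (h₄ : Theses.SevenfoldWeilCensus.WeilSixfolds) : HodgeConjectureFor A.dim A.X :=
  hodgeConjectureFor_of_generated_of_two_seed_sets hA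
    (codimTwoWeilPullbacks_subset_algebraicClasses_of_floor_of_weilClassesCMField hW hR3 A)
    (codimThreeWeilSixfoldPullbacks_subset_algebraicClasses_of_weilSixfolds h₄ A) hgen.1 hgen.2

/-- **(L⁺) `HC(A)` from the two ladder rungs R∞ ∧ R3 alone** (floor = R∞[n = 2], `W₆` = R∞[n = 3]) — `HC_CM`
ABSENT. [cite: MoonenZarhin1998WeilClasses, §1] [cite: Deligne1982HodgeCycles, §4–5] -/
theorem hodgeConjectureFor_of_isFullWeilPullbackGenerated_of_rungs {A : AbelianVariety ℂ} (hA : A.dim ≤ 7)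
    (hgen : IsFullWeilPullbackGenerated A) (hR : WeilClassesImaginaryQuadratic) (hR3 : WeilClassesCMField) :
    HodgeConjectureFor A.dim A.X :=
  hodgeConjectureFor_of_isFullWeilPullbackGenerated_of_floor_of_weilClassesCMField_of_weilSixfolds hA hgen
    (floorFourfolds_of_weilClassesImaginaryQuadratic hR) hR3 (weilSixfolds_of_weilClassesImaginaryQuadratic hR)

/-- **(C⁺) `HC(A)` from HC on a class `𝒞`, the floor fact and the TWO prices off `𝒞`** (codimension-2 CM-field
Weil classes off `𝒞`, Weil sixfolds off `𝒞`). [cite: Andre1992HodgeCM, Théorème] [cite: MoonenZarhin1998WeilClasses, §1]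
[cite: Markman2025SecantWeil, Thm. 1.5.1 (preprint, unrefereed)] -/
theorem hodgeConjectureFor_of_isFullWeilPullbackGenerated_of_floor_of_hcOnClass_of_pricesOff
    {𝒞 : AbelianVariety ℂ → Prop} {A : AbelianVariety ℂ} (hA : A.dim ≤ 7) (hgen : IsFullWeilPullbackGenerated A)
    (hW : Markman2025_weilClasses_algebraic_abelianFourfold) (h𝒞 : HCOnClass 𝒞)
    (h₆ : CodimTwoWeilClassesCMFieldOff 𝒞) (h₄ : WeilSixfoldsOff 𝒞) : HodgeConjectureFor A.dim A.X :=
  hodgeConjectureFor_of_generated_of_two_seed_sets hA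
    (codimTwoWeilPullbacks_subset_algebraicClasses_of_floor_of_hcOnClass_of_priceOff hW h𝒞 h₆ A)
    (codimThreeWeilSixfoldPullbacks_subset_algebraicClasses_of_hcOnClass_of_weilSixfoldsOff h𝒞 h₄ A)
    hgen.1 hgen.2

/-- **(C⁺, `𝒞 = CM`) `HC(A)` from `HC_CM` (binder, by name: HC on the CM locus pays the CM sources — KIND =
INSTANCE), the floor fact and the two prices off the CM locus** (the NON-CM Weil sixfolds and the non-CM
codimension-2 CM-field Weil classes). [cite: Milne1999, §7 (H)] [cite: MoonenZarhin1998WeilClasses, §1] -/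
theorem hodgeConjectureFor_of_isFullWeilPullbackGenerated_of_hcCM_of_floor_of_pricesOffCM
    (hCM : Theses.RankFourFaces.CMAbelianHodge) (hW : Markman2025_weilClasses_algebraic_abelianFourfold)
    (h₆ : CodimTwoWeilClassesCMFieldOff IsOfCMType) (h₄ : WeilSixfoldsOff IsOfCMType) {A : AbelianVariety ℂ}
    (hA : A.dim ≤ 7) (hgen : IsFullWeilPullbackGenerated A) : HodgeConjectureFor A.dim A.X :=
  hodgeConjectureFor_of_isFullWeilPullbackGenerated_of_floor_of_hcOnClass_of_pricesOff hA hgen hW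
    (hcOnClass_cmType_of_hcCM hCM) h₆ h₄

/-- **(T⁺) `HC(A)` from `HC_CM` and the four transport leaves of `Ring2TransportWeilClasses`** (quadratic leaves ⇒
R∞ ⇒ floor and `W₆`; CM-field leaves ⇒ R3; `HC_CM` = the CM anchor of both transports, load-bearing).
[cite: Deligne1982HodgeCycles, §4–5] [cite: Milne1999, §7 (H)] -/
theorem hodgeConjectureFor_of_isFullWeilPullbackGenerated_of_hcCM_of_transport
    (hCM : Theses.RankFourFaces.CMAbelianHodge) (hPq : CMPointedWeilFamiliesQuadratic)
    (hVq : WeilVariationalHodgeQuadratic) (hP : CMPointedWeilFamiliesCMField) (hV : WeilVariationalHodgeCMField)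
    {A : AbelianVariety ℂ} (hA : A.dim ≤ 7) (hgen : IsFullWeilPullbackGenerated A) : HodgeConjectureFor A.dim A.X :=
  hodgeConjectureFor_of_isFullWeilPullbackGenerated_of_rungs hA hgen (HC_WeilClassesQuadratic_of_HC_CM hCM hPq hVq)
    (HC_WeilClassesCMField_of_HC_CM hCM hP hV)

/-- **(P⁺) ⟹ the census clauses at the member**: a fully Weil-pull-back-generated 6- or 7-fold satisfies the
clauses of X2′ (`CodimTwoFromWeilPullbacks`) and X1 (`CodimThreeWeilGeneration`) — their lower-dimensional
summands are simply not needed. Stated OFF a class: if every 6- and 7-fold outside `𝒞` has the shape, the census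
holds off `𝒞`. [cite: MoonenZarhin1999LowDim, Thm. 0.2 (e),(f) and §5] -/
theorem censusOff_of_forall_isFullWeilPullbackGenerated {𝒞 : AbelianVariety ℂ → Prop}
    (hgen : ∀ A : AbelianVariety ℂ, A.dim = 6 ∨ A.dim = 7 → ¬ 𝒞 A → IsFullWeilPullbackGenerated A) :
    CodimTwoFromWeilPullbacksOff 𝒞 ∧ CodimThreeWeilGenerationOff 𝒞 := by
  refine ⟨fun A hA hA𝒞 c hc hct ↦
    codimTwoFromWeilPullbacks_clause_of_isCodimTwoGeneratedBy (hgen A hA hA𝒞).1 c hc hct, fun A hA hA𝒞 c hc hct ↦ ?_⟩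
  obtain ⟨y, hy, z, hz, rfl⟩ := Submodule.mem_sup.1 ((hgen A hA hA𝒞).2 c hc hct)
  exact Submodule.mem_sup.2 ⟨y, Submodule.mem_sup_left hy, z, hz, rfl⟩

/-! ## §K4 Rows `6, 7` from the member shape off a class (no induction on dimension) -/

/-- **Rows `≤ 7` from HC on `𝒞`, the FLOOR `HCUpToDim 5`, the floor fact, the two prices off `𝒞`, and the shape
(P⁺) on every 6- and 7-fold outside `𝒞`.** Compare `hcUpToDim_seven_of_censusOff_weilPullbacks` (p193119): the
census rows X2′ ∧ X1 need an induction on dimension for their lower-dimensional summands; the member shape does not.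
[cite: MoonenZarhin1999LowDim, Thms. 0.1, 0.2 and §5] [cite: Markman2025SecantWeil, Thm. 1.5.1 (preprint, unrefereed)] -/
theorem hcUpToDim_seven_of_forall_isFullWeilPullbackGenerated_off {𝒞 : AbelianVariety ℂ → Prop} (h𝒞 : HCOnClass 𝒞)
    (hgen : ∀ A : AbelianVariety ℂ, A.dim = 6 ∨ A.dim = 7 → ¬ 𝒞 A → IsFullWeilPullbackGenerated A)
    (hW : Markman2025_weilClasses_algebraic_abelianFourfold) (h₆ : CodimTwoWeilClassesCMFieldOff 𝒞)
    (h₄ : WeilSixfoldsOff 𝒞) (h₅ : HCUpToDim 5) : HCUpToDim 7 := by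
  intro A hA
  by_cases hA5 : A.dim ≤ 5
  · exact h₅ A hA5
  · by_cases hA𝒞 : 𝒞 A
    · exact h𝒞 A hA𝒞
    · exact hodgeConjectureFor_of_isFullWeilPullbackGenerated_of_floor_of_hcOnClass_of_pricesOff hA
        (hgen A (by omega) hA𝒞) hW h𝒞 h₆ h₄

/-- **Rows `≤ 7` from `HC_CM` (INSTANCE on the CM rows), the floor, the floor fact, the two prices off the CM locus
and the shape (P⁺) on every NON-CM 6- and 7-fold.** [cite: Milne1999, §7 (H)] [cite: MoonenZarhin1999LowDim, §5] -/
theorem hcUpToDim_seven_of_hcCM_of_forall_isFullWeilPullbackGenerated_offCM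
    (hCM : Theses.RankFourFaces.CMAbelianHodge)
    (hgen : ∀ A : AbelianVariety ℂ, A.dim = 6 ∨ A.dim = 7 → ¬ IsOfCMType A → IsFullWeilPullbackGenerated A)
    (hW : Markman2025_weilClasses_algebraic_abelianFourfold) (h₆ : CodimTwoWeilClassesCMFieldOff IsOfCMType)
    (h₄ : WeilSixfoldsOff IsOfCMType) (h₅ : HCUpToDim 5) : HCUpToDim 7 :=
  hcUpToDim_seven_of_forall_isFullWeilPullbackGenerated_off (hcOnClass_cmType_of_hcCM hCM) hgen hW h₆ h₄ h₅

/-- **The same rows through the census** (consistency with p193119): the shape off `𝒞` gives X2′ ∧ X1 off `𝒞`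
(`censusOff_of_forall_isFullWeilPullbackGenerated`), and the census induction closes rows `≤ 7` with the same
prices. [cite: MoonenZarhin1999LowDim, Thms. 0.1, 0.2 and §5] -/
theorem hcUpToDim_seven_of_forall_isFullWeilPullbackGenerated_off_via_census {𝒞 : AbelianVariety ℂ → Prop}
    (h𝒞 : HCOnClass 𝒞)
    (hgen : ∀ A : AbelianVariety ℂ, A.dim = 6 ∨ A.dim = 7 → ¬ 𝒞 A → IsFullWeilPullbackGenerated A)
    (h₆ : CodimTwoWeilClassesCMFieldOff 𝒞) (h₄ : WeilSixfoldsOff 𝒞) (h₅ : HCUpToDim 5) : HCUpToDim 7 :=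
  hcUpToDim_seven_of_censusOff_weilPullbacks h𝒞 (censusOff_of_forall_isFullWeilPullbackGenerated hgen).1
    (censusOff_of_forall_isFullWeilPullbackGenerated hgen).2 h₄ h₆ h₅

/-- **(R⁺) on a CLASS**: a class of fully Weil-pull-back-generated members of dimension `≤ 7` satisfies HC given
the floor fact ∧ R3 ∧ `W₆` — `HC_CM` ABSENT. [cite: MoonenZarhin1998WeilClasses, §1] [cite: VoisinHodgeI2002, Thms. 6.25, 11.30] -/
theorem hcOnClass_of_isFullWeilPullbackGenerated_of_floor_of_weilClassesCMField_of_weilSixfolds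
    {𝒦 : AbelianVariety ℂ → Prop} (h𝒦 : ∀ A : AbelianVariety ℂ, 𝒦 A → A.dim ≤ 7 ∧ IsFullWeilPullbackGenerated A)
    (hW : Markman2025_weilClasses_algebraic_abelianFourfold) (hR3 : WeilClassesCMField)
    (h₄ : Theses.SevenfoldWeilCensus.WeilSixfolds) : HCOnClass 𝒦 :=
  fun A hA ↦ hodgeConjectureFor_of_isFullWeilPullbackGenerated_of_floor_of_weilClassesCMField_of_weilSixfolds
    (h𝒦 A hA).1 (h𝒦 A hA).2 hW hR3 h₄

/-- **PRODUCT ROWS** (`E × Y₆`, `E² × Y₅`, `E³ × Y₄`, `Y₃ × Y₃′ × E`, `E_{k₂} × Y₆`: typer 2 XIX.2 rows β7.1–3,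
γ7.1–2): `HC(Y × Z)` for `dim Y + dim Z ≤ 7` from the shape of the product and (R⁺)'s prices — `HC_CM` ABSENT.
[cite: vanGeemen1994HodgeAV, Thm. 6.12] [cite: MoonenZarhin1999LowDim, §5] -/
theorem hodgeConjectureFor_prod_of_isFullWeilPullbackGenerated_of_floor_of_weilClassesCMField_of_weilSixfolds
    {Y Z : AbelianVariety ℂ} (hYZ : Y.dim + Z.dim ≤ 7) (hgen : IsFullWeilPullbackGenerated (Y.prod Z))
    (hW : Markman2025_weilClasses_algebraic_abelianFourfold) (hR3 : WeilClassesCMField)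
    (h₄ : Theses.SevenfoldWeilCensus.WeilSixfolds) : HodgeConjectureFor (Y.prod Z).dim (Y.prod Z).X :=
  hodgeConjectureFor_of_isFullWeilPullbackGenerated_of_floor_of_weilClassesCMField_of_weilSixfolds
    (by rw [AbelianVariety.dim_prod]; exact hYZ) hgen hW hR3 h₄

/-! ## §K5 Audit: the prices are on-path; the shapes are hypotheses -/

/-- ON-PATH: both seed sets being algebraic is a consequence of the summit (through the ladder's on-path lemmas for
R∞, R3 and `W₆`). The shapes `IsCodimTwoGeneratedBy` / `IsCodimThreeGeneratedBy` are Hodge-theoretic and stay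
hypotheses. [cite: Deligne2000, §1] -/
theorem fullWeilPullbackGenerated_prices_of_hodgeConjecture (h : _root_.HodgeConjecture) (A : AbelianVariety ℂ) :
    codimTwoWeilPullbacks A ⊆ ↑(algebraicClasses A.X 2) ∧
      codimThreeWeilSixfoldPullbacks A ⊆ ↑(algebraicClasses A.X 3) :=
  ⟨(weilPullbackGenerated_prices_of_hodgeConjecture h A).1,
    codimThreeWeilSixfoldPullbacks_subset_algebraicClasses_of_weilSixfolds
      (WeilTypeLadder.weilSixfolds_of_hodgeConjecture h) A⟩

/-- TRIVIAL SHAPE: a member whose `(3,3)` classes are all algebraic is generated in codimension `3` by the seed set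
of its algebraic classes — so the engine's codimension-`3` hypothesis with THAT seed set is implied by HC on the
member (with the Weil-sixfold seed set it is a census statement, not a consequence of HC). [cite: Deligne2000, §1] -/
theorem isCodimThreeGeneratedBy_algebraicClasses_of_hodgeConjectureFor {A : AbelianVariety ℂ}
    (h : HodgeConjectureFor A.dim A.X) : IsCodimThreeGeneratedBy A ↑(algebraicClasses A.X 3) :=
  fun c hc hct ↦ Submodule.mem_sup_right (Submodule.subset_span (h.2 3 c hc hct))

end Summit.HodgeConjecture.HodgeConjecture.Ring2.ClassTargets

end
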